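import Literature.Probability.Percolation.Z2PivotalCampbellLimit
import Summits.CriticalPhenomena.CardyFormulaZ2.Theorems.CardyMeckeFlipZ2LimitsSymmetricIsometryOfRotation

/-!
# Crux `FlipErgodicityZ2` (stmt-CriticalPhenomena-14825), line `registered`, stub
# `stub_equivariantVersion` (N7): the test-function and configuration perturbation lemmas for the
# almost-sure translation equivariance of joint-limit kernels

Route `Summits/CriticalPhenomena/CardyFormulaZ2/Theses/CardyMeckeFlip`.  Helper file (supports the
crux item).  Clause (ADM)(6) asks that the Garban–Pete–Schramm kernel `M ε` of a bond-`ℤ²` sublimit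
`μ` be equivariant under the isometries of the plane; the provable half of its limit side is
almost-sure TRANSLATION equivariance of every joint-limit kernel (next file,
`…StubEquivariantVersionTranslationEquivariant.lean`).  Its proof compares, along lattice
approximations `w_k = δ_k t_k → v` of a vector `v`, the EXACT lattice identity of joint laws at `w_k`
(`integral_comp_translate_eq_integral_comp_shift_testFunction`, landed) with the two limits at `v`.
This file supplies the two perturbation estimates, for test functionals `ψ(S) χ(r)` with `ψ`
bounded continuous on `ℋ_ℂ` and `χ` `1`-Lipschitz with values in `[0,1]`:

* `tendsto_integral_translate_mul_sub` — **configuration coordinate**: for translation vectors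
  `a_k - b_k → 0`, `E[ψ(a_k + X_k) c_k] - E[ψ(b_k + X_k) c_k] → 0` for any random configurations
  `X_k` and factors `|c_k| ≤ 1` — uniform smallness of `ψ ∘ T_u - ψ` on the COMPACT `ℋ_ℂ`
  (`exists_forall_dist_translate_lt`, joint continuity of the translation action);
* `tendsto_integral_mul_comp_shift_sub` — **test-function coordinate**: along the joint
  convergence in law of `(ω_{δ_k}, ⟨μ^ε_{δ_k}, ·⟩)`,
  `E[ψ(ω_{δ_k}) χ(⟨μ^ε_{δ_k}, φ(w_k + ·)⟩)] - E[ψ(ω_{δ_k}) χ(⟨μ^ε_{δ_k}, φ(v + ·)⟩)] → 0`: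
  `|χ(a) - χ(b)| ≤ min 1 |a - b|`, `|⟨μ^ε_δ, φ(w_k + ·) - φ(v + ·)⟩| ≤ η ⟨μ^ε_δ, Χ⟩` for a fixed bump
  `Χ` once `w_k` is near `v` (uniform continuity of `φ`, `exists_bump_eventually_abs_sub_le`), and
  `E[min 1 (η⟨μ^ε_{δ_k}, Χ⟩)] → ∫ min 1 (η⟨M ε S, Χ⟩) dμ → 0` as `η → 0` (joint convergence, then
  dominated convergence) — the only place where tightness of the real coordinate enters, which is
  why `χ` is taken Lipschitz (cf. `Literature/Probability/Distributions/AEEqOfJointLaw.lean`).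

References: C. Garban, G. Pete, O. Schramm, JAMS 26 (2013), arXiv:1008.1378, §1 p. 10, §4.7.
-/

noncomputable section

open MeasureTheory Set Filter Metric
open Literature.Probability.Percolation Literature.Probability.Percolation.QuadCrossing
open Literature.Probability.LatticeModels Literature.Probability.Distributions
open Summit.CriticalPhenomena.CardyFormulaZ2.Cruxes.LagHandOff.CrosscutDictionary
open scoped ENNReal Topology BoundedContinuousFunction

namespace Summit.CriticalPhenomena.CardyFormulaZ2.Theorems.CardyMeckeFlip

/-! ### Bounded continuous test functionals built from `ψ ⊗ χ` -/

/-- `|χ a - χ b| ≤ min 1 |a - b|` for a `1`-Lipschitz `[0,1]`-valued `χ`. [folklore] -/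
theorem abs_sub_le_min_of_lipschitz {χ : ℝ → ℝ} (hχ : LipschitzWith 1 χ)
    (hχ01 : ∀ r, χ r ∈ Icc (0 : ℝ) 1) (a b : ℝ) : |χ a - χ b| ≤ min 1 |a - b| := by
  refine le_min ?_ ?_
  · rw [abs_sub_le_iff]
    constructor <;> linarith [(hχ01 a).1, (hχ01 a).2, (hχ01 b).1, (hχ01 b).2]
  · have h := hχ.dist_le_mul a b
    rwa [NNReal.coe_one, one_mul, Real.dist_eq, Real.dist_eq] at h

/-- `‖ψ S' * χ r‖ ≤ ‖ψ‖` for `χ` with values in `[0,1]`. [folklore] -/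
theorem norm_mul_le_norm_of_mem_Icc (ψ : QuadConfig (univ : Set ℂ) →ᵇ ℝ) {χ : ℝ → ℝ}
    (hχ01 : ∀ r, χ r ∈ Icc (0 : ℝ) 1) (S : QuadConfig (univ : Set ℂ)) (r : ℝ) :
    ‖ψ S * χ r‖ ≤ ‖ψ‖ := by
  rw [norm_mul]
  calc ‖ψ S‖ * ‖χ r‖ ≤ ‖ψ‖ * 1 := by
        refine mul_le_mul (ψ.norm_coe_le_norm _) ?_ (norm_nonneg _) (norm_nonneg _)
        rw [Real.norm_eq_abs, abs_of_nonneg (hχ01 _).1]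
        exact (hχ01 _).2
    _ = ‖ψ‖ := mul_one _

/-- The product `ψ(T S) χ(r 0)` as a bounded continuous function on `ℋ_ℂ × ℝ¹`, for a continuous
self-map `T` of `ℋ_ℂ`, `ψ` bounded continuous and `χ` continuous with values in `[0,1]`.
[folklore] -/
theorem exists_bcf_mul_comp {T : QuadConfig (univ : Set ℂ) → QuadConfig (univ : Set ℂ)}
    (hT : Continuous T) (ψ : QuadConfig (univ : Set ℂ) →ᵇ ℝ) {χ : ℝ → ℝ} (hχ : Continuous χ)
    (hχ01 : ∀ r, χ r ∈ Icc (0 : ℝ) 1) :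
    ∃ F : QuadConfig (univ : Set ℂ) × (Fin 1 → ℝ) →ᵇ ℝ, ∀ S r, F (S, r) = ψ (T S) * χ (r 0) :=
  ⟨BoundedContinuousFunction.ofNormedAddCommGroup
    (fun p : QuadConfig (univ : Set ℂ) × (Fin 1 → ℝ) => ψ (T p.1) * χ (p.2 0))
    ((ψ.continuous.comp (hT.comp continuous_fst)).mul
      (hχ.comp ((continuous_apply 0).comp continuous_snd))) ‖ψ‖
    (fun p => norm_mul_le_norm_of_mem_Icc ψ hχ01 (T p.1) (p.2 0)), fun _ _ => rfl⟩

/-- The truncation `min 1 (|η| |r 0|)` as a bounded continuous function on `ℋ_ℂ × ℝ¹`.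
[folklore] -/
theorem exists_bcf_min_one (η : ℝ) :
    ∃ F : QuadConfig (univ : Set ℂ) × (Fin 1 → ℝ) →ᵇ ℝ, ∀ S r, F (S, r) = min 1 (|η| * |r 0|) := by
  have hb : ∀ p : QuadConfig (univ : Set ℂ) × (Fin 1 → ℝ), ‖min 1 (|η| * |p.2 0|)‖ ≤ 1 := fun p => by
    rw [Real.norm_eq_abs, abs_of_nonneg (le_min zero_le_one (by positivity))]
    exact min_le_left _ _
  exact ⟨BoundedContinuousFunction.ofNormedAddCommGroup _
    (continuous_const.min (continuous_const.mul
      (continuous_abs.comp ((continuous_apply 0).comp continuous_snd)))) 1 hb, fun S r => rfl⟩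

/-! ### Perturbing the configuration coordinate: small translations on the compact `ℋ_ℂ` -/

/-- **Small relative translations of the configuration are negligible in the mean**: for a
bounded continuous `ψ` on `ℋ_ℂ`, translation vectors `a_k, b_k` with `a_k - b_k → 0`, measurable
random configurations `X_k` and measurable factors `|c_k| ≤ 1`,
`E[ψ(a_k + X_k) c_k] - E[ψ(b_k + X_k) c_k] → 0` (uniform smallness of `ψ ∘ T_u - ψ` on the compact
`ℋ_ℂ`, `exists_forall_dist_translate_lt`). [folklore] -/
theorem tendsto_integral_translate_mul_sub {Ω : Type*} [MeasurableSpace Ω] {P : Measure Ω}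
    [IsProbabilityMeasure P] (ψ : QuadConfig (univ : Set ℂ) →ᵇ ℝ)
    {X : ℕ → Ω → QuadConfig (univ : Set ℂ)} (hX : ∀ k, Measurable (X k)) {c : ℕ → Ω → ℝ}
    (hc : ∀ k, Measurable (c k)) (hc1 : ∀ k ω, |c k ω| ≤ 1) {a b : ℕ → ℂ}
    (hab : Tendsto (fun k => a k - b k) atTop (𝓝 0)) :
    Tendsto (fun k => ∫ ω, ψ (QuadConfig.translate (a k) (X k ω)) * c k ω ∂P -
      ∫ ω, ψ (QuadConfig.translate (b k) (X k ω)) * c k ω ∂P) atTop (𝓝 0) := by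
  have hint : ∀ (u : ℂ) (k : ℕ),
      Integrable (fun ω => ψ (QuadConfig.translate u (X k ω)) * c k ω) P := fun u k => by
    refine Integrable.of_bound ((ψ.continuous.measurable.comp
      ((QuadConfig.measurable_translate u).comp (hX k))).mul (hc k)).aestronglyMeasurable ‖ψ‖
      (ae_of_all _ fun ω => ?_)
    rw [norm_mul]
    calc ‖ψ (QuadConfig.translate u (X k ω))‖ * ‖c k ω‖ ≤ ‖ψ‖ * 1 :=
          mul_le_mul (ψ.norm_coe_le_norm _) (hc1 k ω) (norm_nonneg _) (norm_nonneg _)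
      _ = ‖ψ‖ := mul_one _
  refine NormedAddGroup.tendsto_nhds_zero.2 fun e he => ?_
  obtain ⟨η, hη, hunif⟩ := exists_forall_dist_translate_lt ψ (half_pos he)
  filter_upwards [NormedAddGroup.tendsto_nhds_zero.1 hab η hη] with k hk
  rw [← integral_sub (hint _ k) (hint _ k)]
  have hbound : ∀ ω, ‖ψ (QuadConfig.translate (a k) (X k ω)) * c k ω -
      ψ (QuadConfig.translate (b k) (X k ω)) * c k ω‖ ≤ e / 2 := fun ω => by
    rw [← sub_mul, norm_mul]
    have h1 : ‖ψ (QuadConfig.translate (a k) (X k ω)) -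
        ψ (QuadConfig.translate (b k) (X k ω))‖ < e / 2 := by
      have := hunif (a k - b k) hk (QuadConfig.translate (b k) (X k ω))
      rwa [← translate_add, sub_add_cancel, dist_eq_norm] at this
    calc _ ≤ e / 2 * 1 := mul_le_mul h1.le (hc1 k ω) (abs_nonneg _) (half_pos he).le
      _ = e / 2 := mul_one _
  calc ‖∫ ω, ψ (QuadConfig.translate (a k) (X k ω)) * c k ω -
        ψ (QuadConfig.translate (b k) (X k ω)) * c k ω ∂P‖ ≤ e / 2 * P.real univ :=
        norm_integral_le_of_norm_le_const (ae_of_all _ hbound)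
    _ = e / 2 := by rw [probReal_univ, mul_one]
    _ < e := half_lt_self he

/-! ### Perturbing the test function: `φ(w_k + ·)` against `φ(v + ·)` -/

/-- A continuous compactly supported function and its translates by vectors near `v` differ, on
the lattice kernels, by at most `η` times the mass of a fixed bump: for every `η > 0`, eventually
in `k`, `|⟨μ^ε_δ(ω), φ(w_k + ·)⟩ - ⟨μ^ε_δ(ω), φ(v + ·)⟩| ≤ η ⟨μ^ε_δ(ω), Χ⟩` for all `δ > 0` and
`ω`, where `Χ ∈ C_c(ℂ)`, `0 ≤ Χ ≤ 1`, depends only on `φ` and `v`. [folklore] -/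
theorem exists_bump_eventually_abs_sub_le {φ : ℂ → ℝ} (hφ : Continuous φ)
    (hφc : HasCompactSupport φ) (v : ℂ) {w : ℕ → ℂ} (hw : Tendsto w atTop (𝓝 v)) (ε : ℝ) :
    ∃ Χ : ℂ → ℝ, Continuous Χ ∧ HasCompactSupport Χ ∧ (∀ x, Χ x ∈ Icc (0 : ℝ) 1) ∧
      ∀ η : ℝ, 0 < η → ∀ᶠ k in atTop, ∀ (δ : ℝ), 0 < δ → ∀ ω : BondConfig (Site 2),
        |∫ x, φ (w k + x) ∂(z2PivotalMeasure ε δ ω) - ∫ x, φ (v + x) ∂(z2PivotalMeasure ε δ ω)| ≤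
          η * ∫ x, Χ x ∂(z2PivotalMeasure ε δ ω) := by
  -- the support of `φ` and the bump
  obtain ⟨R, hR⟩ := hφc.isCompact.isBounded.subset_closedBall (0 : ℂ)
  obtain ⟨Χ, hΧ1, -, hΧc, hΧ01⟩ := exists_continuous_one_zero_of_isCompact
    (isCompact_closedBall (0 : ℂ) (R + ‖v‖ + 1)) isClosed_empty (disjoint_empty _)
  refine ⟨Χ, Χ.continuous, hΧc, hΧ01, fun η hη => ?_⟩
  -- uniform continuity of `φ`
  obtain ⟨ρ, hρ, hunif⟩ := Metric.uniformContinuous_iff.1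
    (hφc.uniformContinuous_of_continuous hφ) η hη
  have hnear : ∀ᶠ k in atTop, dist (w k) v < min ρ 1 :=
    Metric.tendsto_nhds.1 hw (min ρ 1) (lt_min hρ zero_lt_one)
  filter_upwards [hnear] with k hk δ hδ ω
  haveI := isFiniteMeasureOnCompacts_z2PivotalMeasure ε hδ ω
  have hkρ : dist (w k) v < ρ := hk.trans_le (min_le_left _ _)
  have hk1 : ‖w k‖ ≤ ‖v‖ + 1 := by
    have h1 : dist (w k) v < 1 := hk.trans_le (min_le_right _ _)
    rw [dist_eq_norm] at h1
    calc ‖w k‖ = ‖(w k - v) + v‖ := by rw [sub_add_cancel]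
      _ ≤ ‖w k - v‖ + ‖v‖ := norm_add_le _ _
      _ ≤ ‖v‖ + 1 := by linarith
  -- pointwise bound `|φ(w_k + x) - φ(v + x)| ≤ η Χ(x)`
  have hpt : ∀ x, |φ (w k + x) - φ (v + x)| ≤ η * Χ x := by
    intro x
    by_cases hx : φ (w k + x) = 0 ∧ φ (v + x) = 0
    · rw [hx.1, hx.2, sub_zero, abs_zero]
      exact mul_nonneg hη.le (hΧ01 x).1
    · have hxK : x ∈ closedBall (0 : ℂ) (R + ‖v‖ + 1) := by
        rw [mem_closedBall, dist_zero_right]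
        rcases not_and_or.1 hx with h | h
        · have hm : w k + x ∈ closedBall (0 : ℂ) R := hR (subset_tsupport _ h)
          rw [mem_closedBall, dist_zero_right] at hm
          calc ‖x‖ = ‖(w k + x) - w k‖ := by rw [add_sub_cancel_left]
            _ ≤ ‖w k + x‖ + ‖w k‖ := norm_sub_le _ _
            _ ≤ R + ‖v‖ + 1 := by linarith
        · have hm : v + x ∈ closedBall (0 : ℂ) R := hR (subset_tsupport _ h)
          rw [mem_closedBall, dist_zero_right] at hm
          calc ‖x‖ = ‖(v + x) - v‖ := by rw [add_sub_cancel_left]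
            _ ≤ ‖v + x‖ + ‖v‖ := norm_sub_le _ _
            _ ≤ R + ‖v‖ + 1 := by linarith
      have h1 : Χ x = 1 := hΧ1 hxK
      rw [h1, mul_one]
      have hd : dist (w k + x) (v + x) < ρ := by rwa [dist_add_right]
      have := hunif hd
      rw [Real.dist_eq] at this
      exact this.le
  -- integrate
  have hi1 : Integrable (fun x => φ (w k + x)) (z2PivotalMeasure ε δ ω) :=
    (hφ.comp (continuous_const_add _)).integrable_of_hasCompactSupport
      (hφc.comp_homeomorph (Homeomorph.addLeft (w k)))
  have hi2 : Integrable (fun x => φ (v + x)) (z2PivotalMeasure ε δ ω) :=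
    (hφ.comp (continuous_const_add _)).integrable_of_hasCompactSupport
      (hφc.comp_homeomorph (Homeomorph.addLeft v))
  have hiΧ : Integrable (fun x => η * Χ x) (z2PivotalMeasure ε δ ω) :=
    (Χ.continuous.integrable_of_hasCompactSupport hΧc).const_mul η
  rw [← integral_sub hi1 hi2, ← integral_const_mul]
  exact (abs_integral_le_integral_abs).trans
    (integral_mono (hi1.sub hi2).abs hiΧ fun x => hpt x)

/-- Dominated convergence for the truncations: `∫ min 1 (|1/(n+1)| |A S|) dμ → 0` for a measurable
`A` and a finite measure `μ`. [folklore] -/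
theorem tendsto_integral_min_one_div (μ : Measure (QuadConfig (univ : Set ℂ))) [IsFiniteMeasure μ]
    {A : QuadConfig (univ : Set ℂ) → ℝ} (hA : Measurable A) :
    Tendsto (fun n : ℕ => ∫ S, min 1 (|1 / ((n : ℝ) + 1)| * |A S|) ∂μ) atTop (𝓝 0) := by
  have h := tendsto_integral_of_dominated_convergence (μ := μ)
    (F := fun (n : ℕ) (S : QuadConfig (univ : Set ℂ)) => min 1 (|1 / ((n : ℝ) + 1)| * |A S|))
    (f := fun _ => 0) (fun _ => (1 : ℝ)) (fun n => ?_) (integrable_const 1) (fun n => ?_) ?_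
  · simpa only [integral_zero] using h
  · exact (measurable_const.min (measurable_const.mul
      (continuous_abs.measurable.comp hA))).aestronglyMeasurable
  · refine ae_of_all _ fun S => ?_
    rw [Real.norm_eq_abs, abs_of_nonneg (le_min zero_le_one (by positivity))]
    exact min_le_left _ _
  · refine ae_of_all _ fun S => ?_
    have h1 : Tendsto (fun n : ℕ => |1 / ((n : ℝ) + 1)| * |A S|) atTop (𝓝 0) := by
      have := ((tendsto_one_div_add_atTop_nhds_zero_nat (𝕜 := ℝ)).abs).mul_const |A S|
      simpa using this
    simpa using (tendsto_const_nhds (x := (1 : ℝ))).min h1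

/-- **The test-function perturbation is negligible in the mean.**  Along a mesh sequence with the
joint convergence in law of `(ω_{δ_k}, ⟨μ^ε_{δ_k}, ·⟩)` to `(S, ⟨M ε S, ·⟩)` (single cutoff, one test
function, bounded continuous test functionals of `ℋ × ℝ¹`), for `w_k → v`, `ψ` bounded continuous
on `ℋ_ℂ` and `χ` `1`-Lipschitz with values in `[0,1]`:
`E[ψ(ω_{δ_k}) χ(⟨μ^ε_{δ_k}, φ(w_k + ·)⟩)] - E[ψ(ω_{δ_k}) χ(⟨μ^ε_{δ_k}, φ(v + ·)⟩)] → 0`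
(`exists_bump_eventually_abs_sub_le`; `E[min 1 (η⟨μ^ε_{δ_k}, Χ⟩)] → ∫ min 1 (η⟨M ε S, Χ⟩) dμ`,
which tends to `0` with `η`, `tendsto_integral_min_one_div`). [folklore] -/
theorem tendsto_integral_mul_comp_shift_sub (μ : FiniteMeasure (QuadConfig (univ : Set ℂ)))
    (M : ℝ → QuadConfig (univ : Set ℂ) → Measure ℂ) (δs : ℕ → ℝ) (hpos : ∀ k, 0 < δs k)
    {ε : ℝ} (hε : 0 < ε) (hM : Measurable (M ε))
    (hjoint : ∀ φ : ℂ → ℝ, Continuous φ → HasCompactSupport φ →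
      ∀ F : QuadConfig (univ : Set ℂ) × (Fin 1 → ℝ) →ᵇ ℝ,
        Tendsto (fun k => ∫ ω, F (z2QuadConfig (univ : Set ℂ) (δs k) ω,
            fun _ => ∫ x, φ x ∂(z2PivotalMeasure ε (δs k) ω)) ∂(bondPercolation (zdGraph 2) half))
          atTop (𝓝 (∫ S, F (S, fun _ => ∫ x, φ x ∂(M ε S))
            ∂(μ : Measure (QuadConfig (univ : Set ℂ))))))
    {φ : ℂ → ℝ} (hφ : Continuous φ) (hφc : HasCompactSupport φ) (v : ℂ) {w : ℕ → ℂ}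
    (hw : Tendsto w atTop (𝓝 v)) (ψ : QuadConfig (univ : Set ℂ) →ᵇ ℝ) {χ : ℝ → ℝ}
    (hχ : LipschitzWith 1 χ) (hχ01 : ∀ r, χ r ∈ Icc (0 : ℝ) 1) :
    Tendsto (fun k =>
      ∫ ω, ψ (z2QuadConfig (univ : Set ℂ) (δs k) ω) *
          χ (∫ x, φ (w k + x) ∂(z2PivotalMeasure ε (δs k) ω)) ∂(bondPercolation (zdGraph 2) half) -
        ∫ ω, ψ (z2QuadConfig (univ : Set ℂ) (δs k) ω) *
          χ (∫ x, φ (v + x) ∂(z2PivotalMeasure ε (δs k) ω)) ∂(bondPercolation (zdGraph 2) half))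
      atTop (𝓝 0) := by
  haveI : IsProbabilityMeasure (bondPercolation (zdGraph 2) half) := by
    unfold bondPercolation; infer_instance
  obtain ⟨Χ, hΧ, hΧc, hΧ01, hev⟩ := exists_bump_eventually_abs_sub_le hφ hφc v hw ε
  have hX : ∀ k, Measurable (z2QuadConfig (univ : Set ℂ) (δs k)) := fun k =>
    measurable_z2QuadConfig isOpen_univ (hpos k)
  have hZ : ∀ k, Measurable fun ω => ∫ x, Χ x ∂(z2PivotalMeasure ε (δs k) ω) := fun k =>
    measurable_integral_z2PivotalMeasure hε (hpos k) hΧ hΧc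
  have hA : Measurable fun S => ∫ x, Χ x ∂(M ε S) :=
    measurable_integral_of_measurable_measure hM hΧ.stronglyMeasurable
  have hshift : ∀ u : ℂ, Continuous (fun x => φ (u + x)) ∧ HasCompactSupport fun x => φ (u + x) :=
    fun u => ⟨hφ.comp (continuous_const_add u), hφc.comp_homeomorph (Homeomorph.addLeft u)⟩
  have hmeasI : ∀ (u : ℂ) (k : ℕ),
      Measurable fun ω => ∫ x, φ (u + x) ∂(z2PivotalMeasure ε (δs k) ω) := fun u k =>
    measurable_integral_z2PivotalMeasure hε (hpos k) (hshift u).1 (hshift u).2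
  -- (a) `E[min 1 (|η| ⟨μ^ε_{δ_k}, Χ⟩)] → ∫ min 1 (|η| ⟨M ε S, Χ⟩) dμ`
  have hJI : ∀ η : ℝ, Tendsto (fun k => ∫ ω, min 1 (|η| * |∫ x, Χ x ∂(z2PivotalMeasure ε (δs k) ω)|)
      ∂(bondPercolation (zdGraph 2) half)) atTop
      (𝓝 (∫ S, min 1 (|η| * |∫ x, Χ x ∂(M ε S)|) ∂(μ : Measure (QuadConfig (univ : Set ℂ))))) := by
    intro η
    obtain ⟨F, hF⟩ := exists_bcf_min_one η
    have h := hjoint Χ hΧ hΧc F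
    simp only [hF] at h
    exact h
  -- (b) `∫ min 1 (|1/(n+1)| ⟨M ε S, Χ⟩) dμ → 0`
  have hI0 := tendsto_integral_min_one_div (μ : Measure (QuadConfig (univ : Set ℂ))) hA
  -- (c) bookkeeping
  refine NormedAddGroup.tendsto_nhds_zero.2 fun e he => ?_
  have hψ1 : 0 < ‖ψ‖ + 1 := by positivity
  have he' : 0 < e / (‖ψ‖ + 1) := div_pos he hψ1
  obtain ⟨n, hn⟩ := ((tendsto_order.1 hI0).2 _ he').exists
  set η : ℝ := 1 / ((n : ℝ) + 1) with hηdef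
  have hη : 0 < η := by positivity
  filter_upwards [(tendsto_order.1 (hJI η)).2 _ hn, hev η hη] with k hk hkpt
  -- integrability of the two integrands and of the dominating function
  have hint : ∀ u : ℂ, Integrable (fun ω => ψ (z2QuadConfig (univ : Set ℂ) (δs k) ω) *
      χ (∫ x, φ (u + x) ∂(z2PivotalMeasure ε (δs k) ω))) (bondPercolation (zdGraph 2) half) :=
    fun u => Integrable.of_bound ((ψ.continuous.measurable.comp (hX k)).mul
      (hχ.continuous.measurable.comp (hmeasI u k))).aestronglyMeasurable ‖ψ‖
      (ae_of_all _ fun ω => norm_mul_le_norm_of_mem_Icc ψ hχ01 _ _)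
  have hdom : Integrable (fun ω => ‖ψ‖ * min 1 (|η| * |∫ x, Χ x ∂(z2PivotalMeasure ε (δs k) ω)|))
      (bondPercolation (zdGraph 2) half) := by
    refine Integrable.of_bound ?_ (‖ψ‖ * 1) (ae_of_all _ fun ω => ?_)
    · exact (measurable_const.mul (measurable_const.min (measurable_const.mul
        (continuous_abs.measurable.comp (hZ k))))).aestronglyMeasurable
    · rw [norm_mul, norm_norm, Real.norm_eq_abs,
        abs_of_nonneg (le_min zero_le_one (by positivity))]
      exact mul_le_mul_of_nonneg_left (min_le_left _ _) (norm_nonneg _)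
  rw [← integral_sub (hint _) (hint _)]
  have hbound : ∀ ω, ‖ψ (z2QuadConfig (univ : Set ℂ) (δs k) ω) *
      χ (∫ x, φ (w k + x) ∂(z2PivotalMeasure ε (δs k) ω)) -
        ψ (z2QuadConfig (univ : Set ℂ) (δs k) ω) *
      χ (∫ x, φ (v + x) ∂(z2PivotalMeasure ε (δs k) ω))‖ ≤
        ‖ψ‖ * min 1 (|η| * |∫ x, Χ x ∂(z2PivotalMeasure ε (δs k) ω)|) := fun ω => by
    rw [← mul_sub, norm_mul]
    refine mul_le_mul (ψ.norm_coe_le_norm _) ?_ (norm_nonneg _) (norm_nonneg _)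
    rw [Real.norm_eq_abs]
    refine (abs_sub_le_min_of_lipschitz hχ hχ01 _ _).trans (min_le_min le_rfl ?_)
    rw [abs_of_pos hη]
    exact (hkpt (δs k) (hpos k) ω).trans (mul_le_mul_of_nonneg_left (le_abs_self _) hη.le)
  have hfin : ‖ψ‖ * (e / (‖ψ‖ + 1)) < e := by
    have h1 : ‖ψ‖ * (e / (‖ψ‖ + 1)) = e - e / (‖ψ‖ + 1) := by
      field_simp
      ring
    rw [h1]
    linarith
  calc ‖∫ ω, ψ (z2QuadConfig (univ : Set ℂ) (δs k) ω) *
          χ (∫ x, φ (w k + x) ∂(z2PivotalMeasure ε (δs k) ω)) -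
        ψ (z2QuadConfig (univ : Set ℂ) (δs k) ω) *
          χ (∫ x, φ (v + x) ∂(z2PivotalMeasure ε (δs k) ω)) ∂(bondPercolation (zdGraph 2) half)‖
        ≤ ∫ ω, ‖ψ‖ * min 1 (|η| * |∫ x, Χ x ∂(z2PivotalMeasure ε (δs k) ω)|)
          ∂(bondPercolation (zdGraph 2) half) :=
        norm_integral_le_of_norm_le hdom (ae_of_all _ hbound)
    _ = ‖ψ‖ * ∫ ω, min 1 (|η| * |∫ x, Χ x ∂(z2PivotalMeasure ε (δs k) ω)|)
          ∂(bondPercolation (zdGraph 2) half) := integral_const_mul _ _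
    _ ≤ ‖ψ‖ * (e / (‖ψ‖ + 1)) := mul_le_mul_of_nonneg_left hk.le (norm_nonneg _)
    _ < e := hfin

/-- **Registered helper headline (N7, test-function perturbation; verbatim signature)** — the
closed form of `tendsto_integral_mul_comp_shift_sub`: along the single-cutoff joint convergence in
law of `(ω_{δ_k}, ⟨μ^ε_{δ_k}, ·⟩)` to `(S, ⟨M ε S, ·⟩)`, for `w_k → v`, `ψ` bounded continuous on `ℋ_ℂ`
and `χ` `1`-Lipschitz with values in `[0,1]`,
`E[ψ(ω_{δ_k}) χ(⟨μ^ε_{δ_k}, φ(w_k + ·)⟩)] - E[ψ(ω_{δ_k}) χ(⟨μ^ε_{δ_k}, φ(v + ·)⟩)] → 0`. [folklore] -/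
theorem jointLaw_shift_testFunction_perturbation :
    ∀ (μ : FiniteMeasure (QuadConfig (Set.univ : Set ℂ)))
      (M : ℝ → QuadConfig (Set.univ : Set ℂ) → Measure ℂ) (δs : ℕ → ℝ), (∀ k, 0 < δs k) →
      ∀ (ε : ℝ), 0 < ε → Measurable (M ε) →
        (∀ φ : ℂ → ℝ, Continuous φ → HasCompactSupport φ →
          ∀ F : BoundedContinuousFunction (QuadConfig (Set.univ : Set ℂ) × (Fin 1 → ℝ)) ℝ,
            Tendsto (fun k => ∫ ω, F (z2QuadConfig (Set.univ : Set ℂ) (δs k) ω,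
                fun _ => ∫ x, φ x ∂(z2PivotalMeasure ε (δs k) ω)) ∂(bondPercolation (zdGraph 2) half))
              atTop (𝓝 (∫ S, F (S, fun _ => ∫ x, φ x ∂(M ε S))
                ∂(μ : Measure (QuadConfig (Set.univ : Set ℂ)))))) →
        ∀ (φ : ℂ → ℝ), Continuous φ → HasCompactSupport φ → ∀ (v : ℂ) (w : ℕ → ℂ),
          Tendsto w atTop (𝓝 v) →
            ∀ (ψ : BoundedContinuousFunction (QuadConfig (Set.univ : Set ℂ)) ℝ) (χ : ℝ → ℝ),
              LipschitzWith 1 χ → (∀ r, χ r ∈ Set.Icc (0 : ℝ) 1) →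
                Tendsto (fun k =>
                  ∫ ω, ψ (z2QuadConfig (Set.univ : Set ℂ) (δs k) ω) *
                      χ (∫ x, φ (w k + x) ∂(z2PivotalMeasure ε (δs k) ω))
                        ∂(bondPercolation (zdGraph 2) half) -
                    ∫ ω, ψ (z2QuadConfig (Set.univ : Set ℂ) (δs k) ω) *
                      χ (∫ x, φ (v + x) ∂(z2PivotalMeasure ε (δs k) ω))
                        ∂(bondPercolation (zdGraph 2) half))
                  atTop (𝓝 0) :=
  fun μ M δs hpos _ hε hM hjoint _ hφ hφc v _ hw ψ _ hχ hχ01 =>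
    tendsto_integral_mul_comp_shift_sub μ M δs hpos hε hM hjoint hφ hφc v hw ψ hχ hχ01

end Summit.CriticalPhenomena.CardyFormulaZ2.Theorems.CardyMeckeFlip

end
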